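import Summits.AtomisticToContinuum.Crystallization.Theorems.ReggeStarCoercivityDefectFreeCrystallizesSqueezeToLayeredA

/-!
# The squeeze modulo gluing: `stub_squeezeToLayered : LayeredGluing → SqueezeClosure`
# (line `prestress-split-korn`, block S5b; crux stmt-AtomisticToContinuum-13603)

Crux `ReggeStarCoercivity.DefectFreeCrystallizes`. `SqueezeClosure := SplitCoercivity → LayeredOfZeroDefects`:
per Lennard-Jones ground-state sequence with defect fraction `→ 0`, layered windows at every scale with ONE
in-layer spacing `a ∈ [47/50, 1]` (the hypothesis of `HullMinimality.PeriodicGivenLayered`, stmt-11779).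
Part A (imported) spends minimality: `#{i : ¬LayeredNear η (x N) i} = o(N)` for every `η > 0`. Here:
* (iii) `squeeze_eventually_exists_centre`: for all large `N` some particle has all particles within `R'` good
  and `η`-layered (packing count around the `o(N)` exceptional sites);
* (v) windows (the matrix of `LayeredOfZeroDefects`, written with labels; no new definition): `squeeze_window_mono`,
  `squeeze_layeredPos_rescale`, `squeeze_window_rescale` (perturbing `a` by `≤ (47/50)·min(ε/2,1)/(R+1)` turns an
  `(R+1, ε/2)`-window into an `(R, ε)`-window: dilate template and heights by `a/a'`, the increment box is kept
  exactly), `squeeze_exists_spacing_of_compact` (the `∃ a` BEFORE `∀ R ε`, by `IsCompact.induction_on` on `[47/50, 1]`);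
* (iv)+(vi) `stub_squeezeToLayered`: the gluing lemma `LayeredGluing` (S5a, sibling files) turns good layered
  centres into windows of SOME spacing eventually; compactness picks ONE spacing frequently.
-/

noncomputable section

open scoped BigOperators Classical InnerProductSpace
open Filter Topology

namespace Summit.AtomisticToContinuum.Crystallization.Theorems.PrestressSplitKorn

open Summit.AtomisticToContinuum.Crystallization.Theses
open Summit.AtomisticToContinuum.Crystallization.Theses.ReggeStarCoercivity
open Summit.AtomisticToContinuum.Crystallization.Theorems.DefectFreeCrystallizes.Negative.PredicateAPI
open Literature.MathematicalPhysics.StatisticalMechanics Literature.Geometry.DiscreteGeometry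

local notation "E3" => EuclideanSpace ℝ (Fin 3)

/-! ## (iii) Good layered centres exist for all large `N` -/

section Centres

/-- **Good centres exist eventually**: under `SplitCoercivity`, along a ground-state sequence with
vanishing defect fraction, for every `η > 0` and every radius `R'`, for all large `N` some particle has ALL
particles within `R'` of it crux-good AND `η`-layered (the exceptional sites are `o(N)`
(`squeeze_tendsto_card_not_layeredNear_div`), and so are the sites within `R'` of them, by the packing count). -/
theorem squeeze_eventually_exists_centre (hSC : SplitCoercivity) (x : (N : ℕ) → (Fin N → E3))
    (hgs : ∀ N, IsGroundState lennardJones (x N))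
    (hdef : Tendsto (fun N : ℕ => (defects (x N) : ℝ) / N) atTop (𝓝 0)) {η : ℝ} (hη : 0 < η)
    (R' : ℝ) :
    ∀ᶠ N : ℕ in atTop, ∃ i : Fin N, ∀ j : Fin N, dist (x N j) (x N i) ≤ R' →
      Good (x N) j ∧ LayeredNear η (x N) j := by
  obtain ⟨δ, hδ, hsepall⟩ := LennardJonesMinimalDistance_holds
  set R₀ : ℝ := max R' 0 with hR₀
  set M : ℝ := (2 * R₀ / δ + 1) ^ 3 with hM
  have hM0 : 0 < M := by positivity
  have hL := squeeze_tendsto_card_not_layeredNear_div hSC x hgs hdef hη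
  have hsumt : Tendsto (fun N : ℕ => M * ((defects (x N) : ℝ) / N +
      ((Finset.univ.filter fun i => ¬ LayeredNear η (x N) i).card : ℝ) / N)) atTop (𝓝 0) := by
    have := (hdef.add hL).const_mul M
    simpa using this
  have h1 : ∀ᶠ N : ℕ in atTop, M * ((defects (x N) : ℝ) / N +
      ((Finset.univ.filter fun i => ¬ LayeredNear η (x N) i).card : ℝ) / N) < 1 :=
    hsumt.eventually_lt_const zero_lt_one
  filter_upwards [h1, eventually_ge_atTop 1] with N hN1 hN3
  have hsep := hsepall N (x N) (hgs N)
  have hNpos : (0 : ℝ) < N := by exact_mod_cast hN3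
  -- the exceptional sites and the sites near them
  set Bad := Finset.univ.filter fun j : Fin N => ¬ (Good (x N) j ∧ LayeredNear η (x N) j) with hBad
  set Blocked := Finset.univ.filter fun i : Fin N => ∃ j ∈ Bad, dist (x N j) (x N i) ≤ R₀ with hBl
  have hBadle : (Bad.card : ℝ) ≤ (defects (x N) : ℝ) +
      ((Finset.univ.filter fun i => ¬ LayeredNear η (x N) i).card : ℝ) := by
    rw [squeeze_defects_eq_card_filter]
    have hsub : Bad ⊆ (Finset.univ.filter fun i : Fin N => ¬ Good (x N) i) ∪
        (Finset.univ.filter fun i => ¬ LayeredNear η (x N) i) := by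
      intro j hj
      have hj' := (Finset.mem_filter.1 hj).2
      rw [not_and_or] at hj'
      rcases hj' with h | h
      · exact Finset.mem_union_left _ (Finset.mem_filter.2 ⟨Finset.mem_univ _, h⟩)
      · exact Finset.mem_union_right _ (Finset.mem_filter.2 ⟨Finset.mem_univ _, h⟩)
    calc (Bad.card : ℝ) ≤ (((Finset.univ.filter fun i : Fin N => ¬ Good (x N) i) ∪
        (Finset.univ.filter fun i => ¬ LayeredNear η (x N) i)).card : ℝ) := by
          exact_mod_cast Finset.card_le_card hsub
      _ ≤ _ := by exact_mod_cast Finset.card_union_le _ _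
  have hBl_le : (Blocked.card : ℝ) ≤ M * Bad.card :=
    squeeze_card_filter_exists_near_le hδ (le_max_right _ _) hsep Bad
  have hBl_lt : (Blocked.card : ℝ) < N := by
    have h2 : M * (Bad.card : ℝ) < N := by
      have h3 : M * (((defects (x N) : ℝ) +
          ((Finset.univ.filter fun i => ¬ LayeredNear η (x N) i).card : ℝ)) / N) < 1 := by
        rwa [add_div]
      rw [← mul_div_assoc, div_lt_iff₀ hNpos, one_mul] at h3
      nlinarith
    linarith
  have hne : Blocked ≠ Finset.univ := by
    intro h
    rw [h, Finset.card_univ, Fintype.card_fin] at hBl_lt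
    exact lt_irrefl _ hBl_lt
  obtain ⟨i, -, hi⟩ : ∃ i ∈ (Finset.univ : Finset (Fin N)), i ∉ Blocked := by
    by_contra h
    push Not at h
    exact hne (Finset.eq_univ_of_forall fun i => h i (Finset.mem_univ i))
  refine ⟨i, fun j hj => ?_⟩
  by_contra hbad
  apply hi
  refine Finset.mem_filter.2 ⟨Finset.mem_univ _, j, Finset.mem_filter.2 ⟨Finset.mem_univ _, hbad⟩, ?_⟩
  exact hj.trans (le_max_left _ _)

end Centres

/-! ## (v) Windows: monotonicity in the scale, rescaling of the spacing, compactness in `a` -/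

section Windows

variable {N : ℕ}

/-- Windows are monotone in the scale: an `(R', ε')`-window of spacing `a` (after a translation `t`, the
particles in `B(0, R')` two-way `ε'`-matched with a rigid image of a box template of spacing `a`, written with
labels) is an `(R, ε)`-window for `R ≤ R'`, `ε' ≤ ε`. -/
theorem squeeze_window_mono {y : Fin N → E3} {R R' ε ε' a : ℝ}
    (h : ∃ (A : E3 →ₗᵢ[ℝ] E3) (t : E3) (s : ℤ → ℤ) (z : ℤ → ℝ), IsHaggSeq s ∧
      (∀ m : ℤ, 39 / 50 * a ≤ z (m + 1) - z m ∧ z (m + 1) - z m ≤ 17 / 20 * a) ∧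
      (∀ l : ℤ × ℤ × ℤ, ‖A (layeredPos a s z l)‖ ≤ R' →
        ∃ i : Fin N, dist (y i + t) (A (layeredPos a s z l)) ≤ ε') ∧
      (∀ i : Fin N, ‖y i + t‖ ≤ R' → ∃ l : ℤ × ℤ × ℤ, dist (y i + t) (A (layeredPos a s z l)) ≤ ε'))
    (hR : R ≤ R') (hε : ε' ≤ ε) :
    ∃ (A : E3 →ₗᵢ[ℝ] E3) (t : E3) (s : ℤ → ℤ) (z : ℤ → ℝ), IsHaggSeq s ∧
      (∀ m : ℤ, 39 / 50 * a ≤ z (m + 1) - z m ∧ z (m + 1) - z m ≤ 17 / 20 * a) ∧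
      (∀ l : ℤ × ℤ × ℤ, ‖A (layeredPos a s z l)‖ ≤ R →
        ∃ i : Fin N, dist (y i + t) (A (layeredPos a s z l)) ≤ ε) ∧
      (∀ i : Fin N, ‖y i + t‖ ≤ R → ∃ l : ℤ × ℤ × ℤ, dist (y i + t) (A (layeredPos a s z l)) ≤ ε) := by
  obtain ⟨A, t, s, z, hs, hz, h1, h2⟩ := h
  refine ⟨A, t, s, z, hs, hz, fun l hl => ?_, fun i hi => ?_⟩
  · obtain ⟨i, hi⟩ := h1 l (hl.trans hR)
    exact ⟨i, hi.trans hε⟩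
  · obtain ⟨l, hl⟩ := h2 i (hi.trans hR)
    exact ⟨l, hl.trans hε⟩

/-- **Rescaling the template**: the in-plane generators are linear in `a`, so the template of spacing `a`
with heights `(a/a')·z` is the `(a/a')`-dilate of the template of spacing `a'` with heights `z`. -/
theorem squeeze_layeredPos_rescale {a a' : ℝ} (ha' : a' ≠ 0) (s : ℤ → ℤ) (z : ℤ → ℝ)
    (l : ℤ × ℤ × ℤ) :
    layeredPos a s (fun m => a / a' * z m) l = (a / a') • layeredPos a' s z l := by
  obtain ⟨m, i, j⟩ := l
  ext k
  fin_cases k <;>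
    simp [layeredPos, triangularVec₁, triangularVec₂, barlowOffset, layerNormal] <;>
    field_simp

/-- **Perturbing the spacing costs one unit of radius and half the tolerance**: an `(R+1, ε/2)`-window
of spacing `a'` is an `(R, ε)`-window of any spacing `a` with `|a − a'|·(R+1) ≤ (47/50)·min(ε/2, 1)`
(both spacings `≥ 47/50`): dilate the template by `a/a'` (heights rescale with it, so the increment box is
kept exactly); template points in `B(0, R+1)` move by at most `|1 − a/a'|·(R+1) ≤ ε/2`. -/
theorem squeeze_window_rescale {y : Fin N → E3} {R ε a a' : ℝ} (hR : 0 ≤ R) (hε : 0 < ε)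
    (ha : 47 / 50 ≤ a) (ha' : 47 / 50 ≤ a')
    (hclose : |a - a'| * (R + 1) ≤ 47 / 50 * min (ε / 2) 1)
    (h : ∃ (A : E3 →ₗᵢ[ℝ] E3) (t : E3) (s : ℤ → ℤ) (z : ℤ → ℝ), IsHaggSeq s ∧
      (∀ m : ℤ, 39 / 50 * a' ≤ z (m + 1) - z m ∧ z (m + 1) - z m ≤ 17 / 20 * a') ∧
      (∀ l : ℤ × ℤ × ℤ, ‖A (layeredPos a' s z l)‖ ≤ R + 1 →
        ∃ i : Fin N, dist (y i + t) (A (layeredPos a' s z l)) ≤ ε / 2) ∧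
      (∀ i : Fin N, ‖y i + t‖ ≤ R + 1 →
        ∃ l : ℤ × ℤ × ℤ, dist (y i + t) (A (layeredPos a' s z l)) ≤ ε / 2)) :
    ∃ (A : E3 →ₗᵢ[ℝ] E3) (t : E3) (s : ℤ → ℤ) (z : ℤ → ℝ), IsHaggSeq s ∧
      (∀ m : ℤ, 39 / 50 * a ≤ z (m + 1) - z m ∧ z (m + 1) - z m ≤ 17 / 20 * a) ∧
      (∀ l : ℤ × ℤ × ℤ, ‖A (layeredPos a s z l)‖ ≤ R →
        ∃ i : Fin N, dist (y i + t) (A (layeredPos a s z l)) ≤ ε) ∧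
      (∀ i : Fin N, ‖y i + t‖ ≤ R → ∃ l : ℤ × ℤ × ℤ, dist (y i + t) (A (layeredPos a s z l)) ≤ ε) := by
  obtain ⟨A, t, s, z, hs, hz, h1, h2⟩ := h
  have ha'0 : (0 : ℝ) < a' := by linarith
  have ha0 : (0 : ℝ) < a := by linarith
  set q : ℝ := a / a' with hq
  have hq0 : 0 < q := div_pos ha0 ha'0
  have hmin0 : 0 < min (ε / 2) 1 := lt_min (by linarith) one_pos
  -- `|1 - q|·(R + 1) ≤ min (ε/2) 1`
  have hu : |1 - q| * (R + 1) ≤ min (ε / 2) 1 := by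
    have e : 1 - q = (a' - a) / a' := by rw [hq]; field_simp
    rw [e, abs_div, abs_of_pos ha'0, abs_sub_comm, div_mul_eq_mul_div, div_le_iff₀ ha'0]
    calc |a - a'| * (R + 1) ≤ 47 / 50 * min (ε / 2) 1 := hclose
      _ ≤ min (ε / 2) 1 * a' := by nlinarith
  have hu1 : |1 - q| * (R + 1) ≤ ε / 2 := hu.trans (min_le_left _ _)
  have hu2 : |1 - q| * (R + 1) ≤ 1 := hu.trans (min_le_right _ _)
  have habs0 : 0 ≤ |1 - q| := abs_nonneg _
  -- the shift of a template point of norm `ρ'` is `|1 - q|·ρ'`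
  have hshift : ∀ v : E3, dist v (q • v) = |1 - q| * ‖v‖ := by
    intro v
    rw [dist_eq_norm, show v - q • v = (1 - q) • v by rw [sub_smul, one_smul], norm_smul,
      Real.norm_eq_abs]
  refine ⟨A, t, s, fun m => q * z m, hs, fun m => ?_, fun l hl => ?_, fun i hi => ?_⟩
  · obtain ⟨hlo, hhi⟩ := hz m
    have e : q * z (m + 1) - q * z m = q * (z (m + 1) - z m) := by ring
    have e1 : 39 / 50 * a = q * (39 / 50 * a') := by rw [hq]; field_simp
    have e2 : 17 / 20 * a = q * (17 / 20 * a') := by rw [hq]; field_simp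
    rw [e, e1, e2]
    exact ⟨mul_le_mul_of_nonneg_left hlo hq0.le, mul_le_mul_of_nonneg_left hhi hq0.le⟩
  · -- a template point of the dilated template in `B(0, R)` comes from one in `B(0, R + 1)`
    rw [squeeze_layeredPos_rescale ha'0.ne' s z l, LinearIsometry.map_smul] at hl ⊢
    set v : E3 := A (layeredPos a' s z l) with hv
    have hvn : ‖v‖ ≤ R + 1 := by
      rw [norm_smul, Real.norm_eq_abs, abs_of_pos hq0] at hl
      by_contra hlt
      push Not at hlt
      nlinarith [le_abs_self (1 - q)]
    obtain ⟨i, hi⟩ := h1 l hvn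
    refine ⟨i, ?_⟩
    calc dist (y i + t) (q • v) ≤ dist (y i + t) v + dist v (q • v) := dist_triangle _ _ _
      _ ≤ ε / 2 + |1 - q| * (R + 1) := by
          rw [hshift v]
          exact add_le_add hi (mul_le_mul_of_nonneg_left hvn habs0)
      _ ≤ ε := by linarith
  · -- a particle in `B(0, R)` is matched in the old window; its partner has norm `≤ R + ε/2`
    obtain ⟨l, hl⟩ := h2 i (hi.trans (by linarith))
    refine ⟨l, ?_⟩
    rw [squeeze_layeredPos_rescale ha'0.ne' s z l, LinearIsometry.map_smul]
    set v : E3 := A (layeredPos a' s z l) with hv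
    have hvn : ‖v‖ ≤ R + ε / 2 := by
      have h3 : ‖v‖ ≤ ‖y i + t‖ + dist (y i + t) v := by
        rw [dist_eq_norm]
        have := norm_sub_norm_le v (y i + t)
        rw [norm_sub_rev] at this
        linarith
      linarith
    have hkey : |1 - q| * (R + ε / 2) ≤ ε / 2 := by
      have h4 : |1 - q| * (R + 1) * (R + ε / 2) ≤ ε / 2 * (R + 1) := by
        nlinarith [mul_le_mul_of_nonneg_right hu1 hR,
          mul_le_mul_of_nonneg_right hu2 (by linarith : (0 : ℝ) ≤ ε / 2)]
      have hR1 : (0 : ℝ) < R + 1 := by linarith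
      by_contra hlt
      push Not at hlt
      nlinarith
    calc dist (y i + t) (q • v) ≤ dist (y i + t) v + dist v (q • v) := dist_triangle _ _ _
      _ ≤ ε / 2 + |1 - q| * (R + ε / 2) := by
          rw [hshift v]
          exact add_le_add hl (mul_le_mul_of_nonneg_left hvn habs0)
      _ ≤ ε := by linarith

/-- **Compactness in the spacing.** For a predicate `P N R ε a` ("configuration `N` has an `(R, ε)`-window of
spacing `a`") that is monotone in the scale and stable under small perturbations of `a` at the cost of one
unit of radius and half the tolerance: if at every scale, eventually in `N`, SOME spacing in `[47/50, 1]`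
works, then ONE spacing `a ∈ [47/50, 1]` works at every scale frequently in `N`. (Contradiction: otherwise
every `a` has a bad scale, hence — by the perturbation property — a neighbourhood bad at a finer scale;
finitely many neighbourhoods cover the compact interval (`IsCompact.induction_on`), and the common
refinement of their scales is bad for every spacing, eventually.) -/
theorem squeeze_exists_spacing_of_compact {P : ℕ → ℝ → ℝ → ℝ → Prop}
    (hmono : ∀ N R R' ε ε' a, R ≤ R' → ε' ≤ ε → P N R' ε' a → P N R ε a)
    (hresc : ∀ N R ε a a', 0 ≤ R → 0 < ε → 47 / 50 ≤ a → 47 / 50 ≤ a' →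
      |a - a'| * (R + 1) ≤ 47 / 50 * min (ε / 2) 1 → P N (R + 1) (ε / 2) a' → P N R ε a)
    (H : ∀ R ε : ℝ, 0 < ε → ∀ᶠ N in atTop, ∃ a, 47 / 50 ≤ a ∧ a ≤ 1 ∧ P N R ε a) :
    ∃ a, 47 / 50 ≤ a ∧ a ≤ 1 ∧ ∀ R ε : ℝ, 0 < ε → ∃ᶠ N in atTop, P N R ε a := by
  by_contra hcon
  push Not at hcon
  set I : Set ℝ := Set.Icc (47 / 50 : ℝ) 1 with hIdef
  have hI : IsCompact I := isCompact_Icc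
  have key : ∃ R ε : ℝ, 0 < ε ∧ ∀ᶠ N in atTop, ∀ a ∈ I, ¬ P N R ε a := by
    apply hI.induction_on (p := fun T => ∃ R ε : ℝ, 0 < ε ∧ ∀ᶠ N in atTop, ∀ a ∈ T, ¬ P N R ε a)
    · exact ⟨0, 1, one_pos, Filter.Eventually.of_forall fun N a ha => ha.elim⟩
    · rintro S T hST ⟨R, ε, hε, h⟩
      exact ⟨R, ε, hε, h.mono fun N hN a ha => hN a (hST ha)⟩
    · rintro S T ⟨R₁, ε₁, hε₁, h₁⟩ ⟨R₂, ε₂, hε₂, h₂⟩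
      refine ⟨max R₁ R₂, min ε₁ ε₂, lt_min hε₁ hε₂, ?_⟩
      filter_upwards [h₁, h₂] with N hN1 hN2
      rintro a (ha | ha)
      · exact fun hP => hN1 a ha (hmono _ _ _ _ _ _ (le_max_left _ _) (min_le_left _ _) hP)
      · exact fun hP => hN2 a ha (hmono _ _ _ _ _ _ (le_max_right _ _) (min_le_right _ _) hP)
    · intro a ha
      obtain ⟨R, ε, hε, hnot⟩ := hcon a ha.1 ha.2
      set R₀ : ℝ := max R 0 with hR₀
      have hmin0 : 0 < min (ε / 2) 1 := lt_min (by linarith) one_pos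
      have hR₀1 : (0 : ℝ) < R₀ + 1 := by positivity
      set γ : ℝ := 47 / 50 * min (ε / 2) 1 / (R₀ + 1) with hγ
      have hγ0 : 0 < γ := by positivity
      refine ⟨I ∩ Metric.ball a γ, inter_mem_nhdsWithin I (Metric.ball_mem_nhds a hγ0), R₀ + 1,
        ε / 2, by positivity, ?_⟩
      filter_upwards [hnot] with N hN a' ha' hP
      apply hN
      apply hmono N R R₀ ε ε a (le_max_left _ _) le_rfl
      refine hresc N R₀ ε a a' (le_max_right _ _) hε ha.1 ha'.1.1 ?_ hP
      have hd : |a - a'| < γ := by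
        rw [← Real.dist_eq, dist_comm]
        exact ha'.2
      rw [hγ, lt_div_iff₀ hR₀1] at hd
      exact hd.le
  obtain ⟨R, ε, hε, hev⟩ := key
  obtain ⟨N, hN1, a, ha1, ha2, hP⟩ := (hev.and (H R ε hε)).exists
  exact hN1 a ⟨ha1, ha2⟩ hP

end Windows

/-! ## S5b: the squeeze modulo gluing -/

/-- **S5b `stub_squeezeToLayered : LayeredGluing → SqueezeClosure`** (= `LayeredGluing → SplitCoercivity →
LayeredOfZeroDefects`). Per ground-state sequence with vanishing defect fraction: `1/3`-separation
(`LennardJonesMinimalDistance_holds`); for each scale `(R, ε)` the gluing lemma names `η, R'`; good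
`η`-layered centres of radius `R'` exist for all large `N` (`squeeze_eventually_exists_centre`, i.e. the squeeze
`squeeze_tendsto_card_not_layeredNear_div` — budget `E(N)/N → e*`, `N e* ≤ E(N)`, site energies bounded below,
packing — plus packing again); gluing gives an `(R, ε)`-window of SOME spacing in `[47/50, 1]` eventually;
compactness in the spacing (`squeeze_exists_spacing_of_compact` with `squeeze_window_mono`, `squeeze_window_rescale`)
gives ONE spacing serving every scale frequently, which is `LayeredOfZeroDefects` for the sequence. -/
theorem stub_squeezeToLayered : LayeredGluing → SqueezeClosure := by
  intro hG hSC x hgs hdef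
  obtain ⟨δ, hδ, hsepall⟩ := LennardJonesMinimalDistance_holds
  -- the window predicate of `LayeredOfZeroDefects`, with labels
  let P : ℕ → ℝ → ℝ → ℝ → Prop := fun N R ε a =>
    ∃ (A : E3 →ₗᵢ[ℝ] E3) (t : E3) (s : ℤ → ℤ) (z : ℤ → ℝ), IsHaggSeq s ∧
      (∀ m : ℤ, 39 / 50 * a ≤ z (m + 1) - z m ∧ z (m + 1) - z m ≤ 17 / 20 * a) ∧
      (∀ l : ℤ × ℤ × ℤ, ‖A (layeredPos a s z l)‖ ≤ R →
        ∃ i : Fin N, dist (x N i + t) (A (layeredPos a s z l)) ≤ ε) ∧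
      (∀ i : Fin N, ‖x N i + t‖ ≤ R → ∃ l : ℤ × ℤ × ℤ, dist (x N i + t) (A (layeredPos a s z l)) ≤ ε)
  have H : ∀ R ε : ℝ, 0 < ε → ∀ᶠ N in atTop, ∃ a, 47 / 50 ≤ a ∧ a ≤ 1 ∧ P N R ε a := by
    intro R ε hε
    obtain ⟨η, hη, R', hglue⟩ := hG δ hδ R ε hε
    filter_upwards [squeeze_eventually_exists_centre hSC x hgs hdef hη R'] with N hN
    obtain ⟨i, hi⟩ := hN
    obtain ⟨A, t, a, s, z, hbox, hs, h1, h2⟩ := hglue N (x N) (hsepall N (x N) (hgs N)) i hi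
    refine ⟨a, hbox.1, hbox.2.1, A, t, s, z, hs, hbox.2.2, fun l hl => h1 _ ⟨l, rfl⟩ hl,
      fun j hj => ?_⟩
    obtain ⟨p, ⟨l, rfl⟩, hp⟩ := h2 j hj
    exact ⟨l, hp⟩
  obtain ⟨a, ha1, ha2, hwin⟩ := squeeze_exists_spacing_of_compact (P := P)
    (fun N R R' ε ε' a hR hε h => squeeze_window_mono h hR hε)
    (fun N R ε a a' hR hε ha ha' hcl h => squeeze_window_rescale hR hε ha ha' hcl h) H
  refine ⟨a, ha1, ha2, fun R ε hε => (hwin R ε hε).mono fun N hN => ?_⟩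
  obtain ⟨A, t, s, z, hs, hz, h1, h2⟩ := hN
  refine ⟨A, t, s, z, hs, hz, ?_, ?_⟩
  · rintro p ⟨m, i, j, rfl⟩ hp
    exact h1 (m, i, j) hp
  · intro i hi
    obtain ⟨l, hl⟩ := h2 i hi
    exact ⟨_, ⟨l.1, l.2.1, l.2.2, rfl⟩, hl⟩

end Summit.AtomisticToContinuum.Crystallization.Theorems.PrestressSplitKorn

end
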